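import Literature.NumberTheory.LFunctions.TruncatedWeilFormPoleNeutralProofs
import HarnessLib

/-!
# RH-FREE — «nothing here bears on the truth of RH»: rigidity of Groskin's Volterra kernel (arXiv:2607.02828, proof of Corollary 2.7) — analytic continuation from `[0,1]` and the secular terms

PROOF LAYER (theorems only, 0 defs, 0 named facts), first steps of STAGE V of the discharge of the claim
`Groskin2026.corollary_2_7` (statement file `TruncatedWeilFormFiniteDictionary.lean`, rh-lit-frontier-1;
reduction `corollary_2_7_of_volterra` in `TruncatedWeilFormPoleNeutralProofs.lean`, this seat). Source:
A. Groskin, *A finite Guinand–Weil dictionary and archimedean tail order for the truncated Weil quadratic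
form*, arXiv:2607.02828v3, proof of Corollary 2.7, p. 8: "If `g_v = g_w`, Fourier injectivity gives
`K_v = K_w` on `[0,1]`, hence as germs …". Written by seat rh-crit-cc-t4 g5.

What is proved here, towards the Volterra integral-domain lemma
`K_v = K_w on [0,1] ⇒ v = ±w`:

* `analyticAt_volterraKernelRe` — the real closed form of `K_v` (this seat's `volterraKernel_eq_sum`:
  a finite sum of `2ω cos 2πωm` and `(sin 2πωm − sin 2πωn)/(π(m − n))`) is real-analytic on `ℝ`;
* `volterraKernel_eq_of_eqOn` — **analytic continuation**: `K_v = K_w` on `[0,1]` implies `K_v = K_w`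
  on all of `ℝ` (identity theorem `AnalyticOnNhd.eqOn_zero_of_preconnected_of_eventuallyEq_zero`);
* `volterraKernel_add_one_sub` — **the secular terms**: `K_v(ω + 1) − K_v(ω) = Σ_m 2u_m² cos(2πωm)`
  (the `2π`-periodicity of `sin`/`cos` kills everything but the `ω cos` terms);
* `sum_sq_mul_cos_eq_of_volterraKernel_eqOn` — hence `K_v = K_w` on `[0,1]` forces
  `Σ_m u_m² cos(2πωm) = Σ_m u′_m² cos(2πωm)` for every real `ω` (`u = evenEmbed N v`, `u′ = evenEmbed N w`);
* `eq_zero_of_sum_mul_cos_eq_zero` — uniqueness of even cosine sums (orthogonality on `[0,1]`), and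
  `sq_evenEmbed_eq_of_volterraKernel_eqOn` — **`K_v = K_w` on `[0,1]` forces `u_m² = u′_m²` for all `m`**.

Remaining for the discharge (recorded, not proved here): the cross terms
(`Σ_{n≠m}(u_mu_n − u′_mu′_n)/(m−n) = 0`) and the partial-fraction step `⇒ u′ = ±u`.

The source is an unrefereed preprint (`[claim: Groskin2026, status: under-review]`); kernel proofs of
these finite trigonometric identities assert nothing on its authority. Nothing here bears on Weil
positivity or on the truth of RH.
-/

noncomputable section

open Filter Set MeasureTheory Complex Finset Matrix
open scoped Real Topology

namespace Literature.NumberTheory.LFunctions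

namespace Groskin2026

/-! ### The real closed form is real-analytic; analytic continuation from `[0, 1]` -/

/-- The real closed form of `K_v` is real-analytic at every point.
[cite: Groskin2026, proof of Lemma 2.2 (p. 5): "entire in `ω`"] -/
theorem analyticAt_volterraKernelRe (N : ℕ) (v : Fin (N + 1) → ℝ) (x : ℝ) :
    AnalyticAt ℝ (fun ω : ℝ ↦ ∑ m : idx N, evenEmbed N v m * ∑ n : idx N,
        (if ((m : ℤ)) = (n : ℤ) then 2 * ω * Real.cos (2 * π * ω * ((m : ℤ) : ℝ))
          else (1 / π * Real.sin (2 * π * ω * ((m : ℤ) : ℝ)) -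
              1 / π * Real.sin (2 * π * ω * ((n : ℤ) : ℝ))) / (((m : ℤ) : ℝ) - ((n : ℤ) : ℝ))) *
          evenEmbed N v n) x := by
  refine Finset.analyticAt_fun_sum _ fun m _ ↦ ?_
  refine analyticAt_const.mul ?_
  refine Finset.analyticAt_fun_sum _ fun n _ ↦ ?_
  refine AnalyticAt.mul ?_ analyticAt_const
  split_ifs with h
  · fun_prop
  · simp_rw [div_eq_mul_inv]
    fun_prop

/-- **Analytic continuation**: `K_v = K_w` on `[0, 1]` implies `K_v = K_w` everywhere on `ℝ`
("hence as germs"). [cite: Groskin2026, Corollary 2.7, proof (p. 8)] -/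
theorem volterraKernel_eq_of_eqOn (N : ℕ) (v w : Fin (N + 1) → ℝ)
    (h : Set.EqOn (volterraKernel N v) (volterraKernel N w) (Set.Icc 0 1)) :
    volterraKernel N v = volterraKernel N w := by
  set rv : ℝ → ℝ := fun ω : ℝ ↦ ∑ m : idx N, evenEmbed N v m * ∑ n : idx N,
        (if ((m : ℤ)) = (n : ℤ) then 2 * ω * Real.cos (2 * π * ω * ((m : ℤ) : ℝ))
          else (1 / π * Real.sin (2 * π * ω * ((m : ℤ) : ℝ)) -
              1 / π * Real.sin (2 * π * ω * ((n : ℤ) : ℝ))) / (((m : ℤ) : ℝ) - ((n : ℤ) : ℝ))) *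
          evenEmbed N v n with hrv
  set rw : ℝ → ℝ := fun ω : ℝ ↦ ∑ m : idx N, evenEmbed N w m * ∑ n : idx N,
        (if ((m : ℤ)) = (n : ℤ) then 2 * ω * Real.cos (2 * π * ω * ((m : ℤ) : ℝ))
          else (1 / π * Real.sin (2 * π * ω * ((m : ℤ) : ℝ)) -
              1 / π * Real.sin (2 * π * ω * ((n : ℤ) : ℝ))) / (((m : ℤ) : ℝ) - ((n : ℤ) : ℝ))) *
          evenEmbed N w n with hrw
  have hv : ∀ ω, volterraKernel N v ω = ((rv ω : ℝ) : ℂ) := fun ω ↦ volterraKernel_eq_sum N v ω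
  have hw : ∀ ω, volterraKernel N w ω = ((rw ω : ℝ) : ℂ) := fun ω ↦ volterraKernel_eq_sum N w ω
  have hD : AnalyticOnNhd ℝ (fun ω ↦ rv ω - rw ω) Set.univ := fun x _ ↦
    (analyticAt_volterraKernelRe N v x).sub (analyticAt_volterraKernelRe N w x)
  have hzero : (fun ω ↦ rv ω - rw ω) =ᶠ[𝓝 (1 / 2 : ℝ)] 0 := by
    filter_upwards [Ioo_mem_nhds (show (0:ℝ) < 1 / 2 by norm_num)
      (show (1 / 2 : ℝ) < 1 by norm_num)] with ω hω
    have h1 := h (Ioo_subset_Icc_self hω)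
    rw [hv, hw] at h1
    have h2 : rv ω = rw ω := by exact_mod_cast h1
    simp [h2]
  have hall := hD.eqOn_zero_of_preconnected_of_eventuallyEq_zero isPreconnected_univ
    (Set.mem_univ _) hzero
  funext ω
  rw [hv, hw]
  have h3 := hall (Set.mem_univ ω)
  simp only [Pi.zero_apply, sub_eq_zero] at h3
  rw [h3]

/-! ### The secular terms: `K_v(ω + 1) − K_v(ω) = Σ_m 2u_m² cos(2πωm)` -/

/-- **The shift identity** `K_v(ω + 1) − K_v(ω) = Σ_m 2u_m² cos(2πωm)`: the entries of the closed
form are `1`-periodic in `ω` except for the factor `ω` of the diagonal terms `2ω cos(2πωm)`.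
[cite: Groskin2026, proof of Lemma 2.3 (p. 5)] -/
theorem volterraKernel_add_one_sub (N : ℕ) (v : Fin (N + 1) → ℝ) (ω : ℝ) :
    volterraKernel N v (ω + 1) - volterraKernel N v ω =
      ((∑ m : idx N, 2 * evenEmbed N v m ^ 2 * Real.cos (2 * π * ω * ((m : ℤ) : ℝ)) : ℝ) : ℂ) := by
  rw [volterraKernel_eq_sum, volterraKernel_eq_sum, ← Complex.ofReal_sub]
  congr 1
  have hcos : ∀ m : idx N, Real.cos (2 * π * (ω + 1) * ((m : ℤ) : ℝ)) =
      Real.cos (2 * π * ω * ((m : ℤ) : ℝ)) := by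
    intro m
    rw [show 2 * π * (ω + 1) * ((m : ℤ) : ℝ) = 2 * π * ω * ((m : ℤ) : ℝ) + ((m : ℤ) : ℝ) * (2 * π)
      by ring, Real.cos_add_int_mul_two_pi]
  have hsin : ∀ m : idx N, Real.sin (2 * π * (ω + 1) * ((m : ℤ) : ℝ)) =
      Real.sin (2 * π * ω * ((m : ℤ) : ℝ)) := by
    intro m
    rw [show 2 * π * (ω + 1) * ((m : ℤ) : ℝ) = 2 * π * ω * ((m : ℤ) : ℝ) + ((m : ℤ) : ℝ) * (2 * π)
      by ring, Real.sin_add_int_mul_two_pi]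
  rw [← Finset.sum_sub_distrib]
  refine Finset.sum_congr rfl fun m _ ↦ ?_
  rw [← mul_sub, ← Finset.sum_sub_distrib]
  have hinner : ∑ n : idx N,
      ((if ((m : ℤ)) = (n : ℤ) then 2 * (ω + 1) * Real.cos (2 * π * (ω + 1) * ((m : ℤ) : ℝ))
          else (1 / π * Real.sin (2 * π * (ω + 1) * ((m : ℤ) : ℝ)) -
              1 / π * Real.sin (2 * π * (ω + 1) * ((n : ℤ) : ℝ))) / (((m : ℤ) : ℝ) - ((n : ℤ) : ℝ))) *
          evenEmbed N v n -
        (if ((m : ℤ)) = (n : ℤ) then 2 * ω * Real.cos (2 * π * ω * ((m : ℤ) : ℝ))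
          else (1 / π * Real.sin (2 * π * ω * ((m : ℤ) : ℝ)) -
              1 / π * Real.sin (2 * π * ω * ((n : ℤ) : ℝ))) / (((m : ℤ) : ℝ) - ((n : ℤ) : ℝ))) *
          evenEmbed N v n) =
      ∑ n : idx N, (if m = n then 2 * Real.cos (2 * π * ω * ((m : ℤ) : ℝ)) * evenEmbed N v n
        else 0) := by
    refine Finset.sum_congr rfl fun n _ ↦ ?_
    by_cases hmn : m = n
    · subst hmn
      simp only [if_true, hcos]
      ring
    · have hmn' : ((m : ℤ)) ≠ (n : ℤ) := fun h ↦ hmn (Subtype.ext h)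
      simp only [hmn', hmn, if_false, hsin]
      ring
  rw [hinner, Finset.sum_ite_eq]
  simp only [Finset.mem_univ, if_true]
  ring

/-- **`K_v = K_w` on `[0,1]` determines the secular terms**: for every real `ω`,
`Σ_m u_m² cos(2πωm) = Σ_m u′_m² cos(2πωm)`. [cite: Groskin2026, Corollary 2.7, proof (p. 8)] -/
theorem sum_sq_mul_cos_eq_of_volterraKernel_eqOn (N : ℕ) (v w : Fin (N + 1) → ℝ)
    (h : Set.EqOn (volterraKernel N v) (volterraKernel N w) (Set.Icc 0 1)) (ω : ℝ) :
    ∑ m : idx N, evenEmbed N v m ^ 2 * Real.cos (2 * π * ω * ((m : ℤ) : ℝ)) =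
      ∑ m : idx N, evenEmbed N w m ^ 2 * Real.cos (2 * π * ω * ((m : ℤ) : ℝ)) := by
  have hall := volterraKernel_eq_of_eqOn N v w h
  have h1 := volterraKernel_add_one_sub N v ω
  have h2 := volterraKernel_add_one_sub N w ω
  rw [hall] at h1
  rw [h1] at h2
  have h3 : ∑ m : idx N, 2 * evenEmbed N v m ^ 2 * Real.cos (2 * π * ω * ((m : ℤ) : ℝ)) =
      ∑ m : idx N, 2 * evenEmbed N w m ^ 2 * Real.cos (2 * π * ω * ((m : ℤ) : ℝ)) := by
    exact_mod_cast h2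
  have h4 : ∑ m : idx N, 2 * evenEmbed N v m ^ 2 * Real.cos (2 * π * ω * ((m : ℤ) : ℝ)) =
      2 * ∑ m : idx N, evenEmbed N v m ^ 2 * Real.cos (2 * π * ω * ((m : ℤ) : ℝ)) := by
    rw [Finset.mul_sum]; refine Finset.sum_congr rfl fun m _ ↦ by ring
  have h5 : ∑ m : idx N, 2 * evenEmbed N w m ^ 2 * Real.cos (2 * π * ω * ((m : ℤ) : ℝ)) =
      2 * ∑ m : idx N, evenEmbed N w m ^ 2 * Real.cos (2 * π * ω * ((m : ℤ) : ℝ)) := by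
    rw [Finset.mul_sum]; refine Finset.sum_congr rfl fun m _ ↦ by ring
  rw [h4, h5] at h3
  linarith

/-! ### Trigonometric uniqueness and the moduli `u_m²` -/

/-- `∫₀¹ cos(2πjω) dω = [j = 0]` for an integer `j`. [folklore] -/
private theorem integral_cos_two_pi_int_mul (j : ℤ) :
    ∫ ω in (0 : ℝ)..1, Real.cos (2 * π * j * ω) = if j = 0 then 1 else 0 := by
  by_cases hj : j = 0
  · simp [hj]
  · have hc : (2 * π * (j : ℝ)) ≠ 0 := by
      have : (j : ℝ) ≠ 0 := by exact_mod_cast hj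
      positivity
    rw [if_neg hj, intervalIntegral.integral_comp_mul_left (fun x ↦ Real.cos x) hc, integral_cos]
    have h1 : Real.sin (2 * π * (j : ℝ)) = 0 := by
      rw [show 2 * π * (j : ℝ) = ((2 * j : ℤ) : ℝ) * π by push_cast; ring]
      exact Real.sin_int_mul_pi _
    simp [h1]

/-- `∫₀¹ cos(2πmω) cos(2πkω) dω = ½([m = k] + [m = −k])` for integers `m, k`. [folklore] -/
private theorem integral_cos_mul_cos_int (m k : ℤ) :
    ∫ ω in (0 : ℝ)..1, Real.cos (2 * π * m * ω) * Real.cos (2 * π * k * ω) =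
      1 / 2 * ((if m = k then 1 else 0) + (if m = -k then 1 else 0)) := by
  have hprod : ∀ ω : ℝ, Real.cos (2 * π * m * ω) * Real.cos (2 * π * k * ω) =
      1 / 2 * Real.cos (2 * π * ((m - k : ℤ) : ℝ) * ω) +
        1 / 2 * Real.cos (2 * π * ((m + k : ℤ) : ℝ) * ω) := by
    intro ω
    have h1 : 2 * π * ((m - k : ℤ) : ℝ) * ω = 2 * π * m * ω - 2 * π * k * ω := by push_cast; ring
    have h2 : 2 * π * ((m + k : ℤ) : ℝ) * ω = 2 * π * m * ω + 2 * π * k * ω := by push_cast; ring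
    rw [h1, h2, Real.cos_sub, Real.cos_add]
    ring
  simp_rw [hprod]
  rw [intervalIntegral.integral_add (by apply Continuous.intervalIntegrable; fun_prop)
    (by apply Continuous.intervalIntegrable; fun_prop),
    intervalIntegral.integral_const_mul, intervalIntegral.integral_const_mul,
    integral_cos_two_pi_int_mul, integral_cos_two_pi_int_mul]
  have e1 : (m - k = 0) ↔ (m = k) := sub_eq_zero
  have e2 : (m + k = 0) ↔ (m = -k) := add_eq_zero_iff_eq_neg
  simp only [e1, e2]
  ring

/-- **Uniqueness of even cosine sums**: if `Σ_{m ∈ I_N} c_m cos(2πωm) = 0` for every real `ω` and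
`c_{−m} = c_m`, then `c = 0` (orthogonality of `cos(2πmω)` on `[0, 1]`).
[cite: Groskin2026, Corollary 2.7, proof (p. 8)] -/
theorem eq_zero_of_sum_mul_cos_eq_zero {N : ℕ} (c : idx N → ℝ)
    (hc : ∀ m, c (negIdx N m) = c m)
    (h : ∀ ω : ℝ, ∑ m : idx N, c m * Real.cos (2 * π * ω * ((m : ℤ) : ℝ)) = 0) (k : idx N) :
    c k = 0 := by
  -- integrate the identity against `cos(2πkω)` over `[0,1]`
  have hint : ∫ ω in (0 : ℝ)..1,
      (∑ m : idx N, c m * Real.cos (2 * π * ω * ((m : ℤ) : ℝ))) * Real.cos (2 * π * ((k : ℤ) : ℝ) * ω)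
        = 0 := by
    rw [show (fun ω : ℝ ↦ (∑ m : idx N, c m * Real.cos (2 * π * ω * ((m : ℤ) : ℝ))) *
        Real.cos (2 * π * ((k : ℤ) : ℝ) * ω)) = fun _ ↦ 0 from
      funext fun ω ↦ by rw [h ω, zero_mul]]
    simp
  have hexp : ∫ ω in (0 : ℝ)..1,
      (∑ m : idx N, c m * Real.cos (2 * π * ω * ((m : ℤ) : ℝ))) * Real.cos (2 * π * ((k : ℤ) : ℝ) * ω)
        = ∑ m : idx N, c m * (1 / 2 * ((if ((m : ℤ)) = (k : ℤ) then 1 else 0) +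
            (if ((m : ℤ)) = -(k : ℤ) then 1 else 0))) := by
    have hrw : ∀ ω : ℝ, (∑ m : idx N, c m * Real.cos (2 * π * ω * ((m : ℤ) : ℝ))) *
        Real.cos (2 * π * ((k : ℤ) : ℝ) * ω) =
        ∑ m : idx N, c m * (Real.cos (2 * π * ((m : ℤ) : ℝ) * ω) * Real.cos (2 * π * ((k : ℤ) : ℝ) * ω)) := by
      intro ω
      rw [Finset.sum_mul]
      refine Finset.sum_congr rfl fun m _ ↦ ?_
      rw [show 2 * π * ω * ((m : ℤ) : ℝ) = 2 * π * ((m : ℤ) : ℝ) * ω by ring]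
      ring
    simp_rw [hrw]
    rw [intervalIntegral.integral_finsetSum (fun m _ ↦ by
      apply Continuous.intervalIntegrable; fun_prop)]
    refine Finset.sum_congr rfl fun m _ ↦ ?_
    rw [intervalIntegral.integral_const_mul, integral_cos_mul_cos_int]
  rw [hexp] at hint
  -- evaluate the Kronecker sums
  have hk1 : ∀ m : idx N, (((m : ℤ)) = (k : ℤ)) ↔ m = k := fun m ↦ Subtype.ext_iff.symm
  have hk2 : ∀ m : idx N, (((m : ℤ)) = -(k : ℤ)) ↔ m = negIdx N k := by
    intro m
    rw [← coe_negIdx]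
    exact Subtype.ext_iff.symm
  simp_rw [hk1, hk2] at hint
  have hsplit : ∑ m : idx N, c m * (1 / 2 * ((if m = k then (1:ℝ) else 0) +
      (if m = negIdx N k then (1:ℝ) else 0))) =
      1 / 2 * ∑ m : idx N, (if m = k then c m else 0) +
        1 / 2 * ∑ m : idx N, (if m = negIdx N k then c m else 0) := by
    rw [Finset.mul_sum, Finset.mul_sum, ← Finset.sum_add_distrib]
    refine Finset.sum_congr rfl fun m _ ↦ ?_
    split_ifs <;> ring
  rw [hsplit, Finset.sum_ite_eq' Finset.univ k, Finset.sum_ite_eq' Finset.univ (negIdx N k)] at hint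
  simp only [Finset.mem_univ, if_true, hc k] at hint
  linarith

/-- **The moduli of the Galerkin coefficients are determined by `K_v` on `[0,1]`**:
`K_v = K_w` on `[0,1]` implies `u_m² = u′_m²` for every `m ∈ I_N`.
[cite: Groskin2026, Corollary 2.7, proof (p. 8)] -/
theorem sq_evenEmbed_eq_of_volterraKernel_eqOn (N : ℕ) (v w : Fin (N + 1) → ℝ)
    (h : Set.EqOn (volterraKernel N v) (volterraKernel N w) (Set.Icc 0 1)) (m : idx N) :
    evenEmbed N v m ^ 2 = evenEmbed N w m ^ 2 := by
  have hcos := sum_sq_mul_cos_eq_of_volterraKernel_eqOn N v w h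
  have hzero : ∀ ω : ℝ, ∑ m : idx N, (evenEmbed N v m ^ 2 - evenEmbed N w m ^ 2) *
      Real.cos (2 * π * ω * ((m : ℤ) : ℝ)) = 0 := by
    intro ω
    simp only [sub_mul, Finset.sum_sub_distrib, hcos ω, sub_self]
  have heven : ∀ m : idx N, (evenEmbed N v (negIdx N m) ^ 2 - evenEmbed N w (negIdx N m) ^ 2) =
      evenEmbed N v m ^ 2 - evenEmbed N w m ^ 2 := by
    intro m; rw [evenEmbed_negIdx, evenEmbed_negIdx]
  have := eq_zero_of_sum_mul_cos_eq_zero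
    (fun m ↦ evenEmbed N v m ^ 2 - evenEmbed N w m ^ 2) heven hzero m
  linarith

end Groskin2026

end Literature.NumberTheory.LFunctions

end
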